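import Summits.QuantumFields.BalabanUV.Beta.GAN24.FibreBlockSolve

/-!
# `BalabanUV.Beta.GAN24.TransverseProjector` — binder row G-an2-4 / (CONV-C), road P1-fibre, table row P1-L08a of `LEMMAS.md` § GAN24 SKELETON-P1
# (dependency-free sub-part of the crux leaf P1-L08 = `SKELETON-P1.md` A4′(iv), the EXACT `m = 0` CANCELLATION, as algebra over `Fin D → ℂ`):
# the TRANSVERSE PROJECTOR of one fine momentum and the cancellation lemma

NOT IN PRINT; OUR PROOF ATTEMPT.  HONEST FRAMING (cell contract, verbatim): «discharging `BetaPertH` makes Bałaban's UV stability UNCONDITIONAL — a real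
constructive-QFT result; it is NOT the continuum limit and NOT the Clay problem.»  HONEST DEPENDENCY (verbatim): «continuum YM on T⁴ ⇐ BetaPertH ∧ nine spine
estimates (0/9 proved); BetaPertH ⇐ (D1) ∧ (D4) ∧ CAP+tail; G-an2-4 gates asym, D1 and NE2/3/4.»  [folklore] finite-dimensional linear algebra over `ℂ` (no estimate,
no cited fact, no wall binder).  Discharges NOTHING of the K-slot of (CONV-C); NOT summit progress.

## What is proved (generic dimension `D`; the conventions of `GAN24/FibreBlockSolve`: vectors `∂ = dd`, `∂♭ = db : Fin D → ℂ`, the bilinear `dot`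
(no conjugation), the Laplacian symbol `L` with `dot db dd = L` and `L ≠ 0`, i.e. `(p, m) ≠ (0, 0)`)
* `projT dd db L v := v − (∂♭·v / L)·∂` — the transverse projector `Π⊥ = 1 − ∂ ∂♭ᵀ/L` of `SKELETON-P1.md` S1b′;
* `dot_projT` (`u·Π⊥v = u·v − (∂♭·v/L)(u·∂)`), `dot_db_projT` (`∂♭·Π⊥v = 0`: the range is TRANSVERSE), `projT_dd` (`Π⊥∂ = 0`: pure gauge is killed),
  `projT_smul_dd`, `projT_of_transverse` (`∂♭·v = 0 ⇒ Π⊥v = v`), `projT_idem` (`Π⊥Π⊥ = Π⊥`), linearity `projT_add` / `projT_smul` / `projT_zero`,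
  and the HELMHOLTZ DECOMPOSITION `self_eq_projT_add` (`v = Π⊥v + (∂♭·v/L)·∂`);
* `eq_zero_of_projT_eq_smul_dd`: a transverse vector that is longitudinal vanishes — `Π⊥X = t·∂ ⇒ t = 0` (hence `t·∂ = 0`);
* `cancellation` (**A4′(iv)**): for a diagonal weight `σ♭`, scalars `S ≠ 0`, `χ`, `w₀ = S·χ`, vectors `f, φ` and a scalar `t`,
  `Π⊥(κ ↦ w₀ σ♭_κ φ_κ + S f_κ) = t·∂  ⇒  t·∂ = 0 ∧ Π⊥(κ ↦ f_κ + χ σ♭_κ φ_κ) = 0`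
  — in S1b′ this is the statement that the `m = 0` capacitance equation makes the field feed `f̂(0) + χ̂₀Σ̄₀φ` LONGITUDINAL, so that the transverse zero-mode pole
  `Π⊥₀/(2L₀)` of the field block is removed EXACTLY by the constraint feed (the residual comes from the `m ≠ 0` aliases only).
Consumed by row P1-L08 (`GAN24/CapacitanceEndpoint`, after L05b/L06/L07).  Companion identities at REAL momenta (`∂♭ = conj ∂`, `L = Σ‖∂_κ‖²`, the
Lagrange–Gaffney norm identity) are in `GAN24/FibreGaffney` (row P1-N08) and are not repeated here.
-/

noncomputable section

open Finset
open scoped BigOperators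

namespace Summit.QuantumFields.BalabanUV.Beta.GAN24.TransverseProjector

open FibreBlockSolve (dot dot_add_right dot_smul_right)

variable {D : ℕ}

/-- [folklore] THE TRANSVERSE PROJECTOR of one fine momentum: `Π⊥v = v − (∂♭·v / L)·∂` (`Π⊥ = 1 − ∂∂♭ᵀ/L`). -/
def projT (dd db : Fin D → ℂ) (L : ℂ) (v : Fin D → ℂ) : Fin D → ℂ :=
  fun κ => v κ - (dot db v / L) * dd κ

/-- [folklore] Componentwise form of `projT`. -/
theorem projT_apply (dd db : Fin D → ℂ) (L : ℂ) (v : Fin D → ℂ) (κ : Fin D) :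
    projT dd db L v κ = v κ - (dot db v / L) * dd κ := rfl

/-! ### 1. Pairings with the projector -/

/-- [folklore] `u·Π⊥v = u·v − (∂♭·v / L)·(u·∂)` for every `u` (no hypothesis on `L`). -/
theorem dot_projT (dd db : Fin D → ℂ) (L : ℂ) (u v : Fin D → ℂ) :
    dot u (projT dd db L v) = dot u v - (dot db v / L) * dot u dd := by
  unfold projT dot
  simp only [mul_sub, Finset.sum_sub_distrib]
  congr 1
  rw [Finset.mul_sum]
  exact Finset.sum_congr rfl fun κ _ => by ring

/-- [folklore] **THE RANGE IS TRANSVERSE**: `∂♭·Π⊥v = 0` (uses `∂♭·∂ = L ≠ 0`). -/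
theorem dot_db_projT (dd db : Fin D → ℂ) {L : ℂ} (hL : L ≠ 0) (hLdef : dot db dd = L) (v : Fin D → ℂ) :
    dot db (projT dd db L v) = 0 := by
  rw [dot_projT, hLdef, div_mul_cancel₀ _ hL, sub_self]

/-! ### 2. Kernel, fixed vectors, idempotence -/

/-- [folklore] **PURE GAUGE IS KILLED**: `Π⊥∂ = 0`. -/
theorem projT_dd (dd db : Fin D → ℂ) {L : ℂ} (hL : L ≠ 0) (hLdef : dot db dd = L) : projT dd db L dd = 0 := by
  funext κ
  rw [projT_apply, hLdef, div_self hL, one_mul, sub_self, Pi.zero_apply]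

/-- [folklore] … and so is every multiple of `∂`: `Π⊥(t·∂) = 0`. -/
theorem projT_smul_dd (dd db : Fin D → ℂ) {L : ℂ} (hL : L ≠ 0) (hLdef : dot db dd = L) (t : ℂ) :
    projT dd db L (fun κ => t * dd κ) = 0 := by
  funext κ
  rw [projT_apply, dot_smul_right, hLdef, Pi.zero_apply]
  field_simp
  ring

/-- [folklore] **TRANSVERSE VECTORS ARE FIXED**: `∂♭·v = 0 ⇒ Π⊥v = v` (no hypothesis on `L`). -/
theorem projT_of_transverse (dd db : Fin D → ℂ) (L : ℂ) {v : Fin D → ℂ} (hv : dot db v = 0) : projT dd db L v = v := by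
  funext κ
  rw [projT_apply, hv, zero_div, zero_mul, sub_zero]

/-- [folklore] **IDEMPOTENCE**: `Π⊥(Π⊥v) = Π⊥v`. -/
theorem projT_idem (dd db : Fin D → ℂ) {L : ℂ} (hL : L ≠ 0) (hLdef : dot db dd = L) (v : Fin D → ℂ) :
    projT dd db L (projT dd db L v) = projT dd db L v :=
  projT_of_transverse dd db L (dot_db_projT dd db hL hLdef v)

/-- [folklore] `Π⊥ 0 = 0`. -/
theorem projT_zero (dd db : Fin D → ℂ) (L : ℂ) : projT dd db L 0 = 0 := by
  funext κ
  simp [projT_apply, dot]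

/-! ### 3. Linearity and the Helmholtz decomposition -/

/-- [folklore] Additivity: `Π⊥(v + w) = Π⊥v + Π⊥w`. -/
theorem projT_add (dd db : Fin D → ℂ) (L : ℂ) (v w : Fin D → ℂ) :
    projT dd db L (v + w) = projT dd db L v + projT dd db L w := by
  funext κ
  simp only [projT_apply, Pi.add_apply, dot_add_right]
  ring

/-- [folklore] Homogeneity: `Π⊥(c·v) = c·Π⊥v`. -/
theorem projT_smul (dd db : Fin D → ℂ) (L : ℂ) (c : ℂ) (v : Fin D → ℂ) :
    projT dd db L (fun κ => c * v κ) = fun κ => c * projT dd db L v κ := by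
  funext κ
  simp only [projT_apply, dot_smul_right]
  ring

/-- [folklore] Linear combinations: `Π⊥(κ ↦ a v_κ + b w_κ) = κ ↦ a (Π⊥v)_κ + b (Π⊥w)_κ`. -/
theorem projT_lincomb (dd db : Fin D → ℂ) (L : ℂ) (a b : ℂ) (v w : Fin D → ℂ) :
    projT dd db L (fun κ => a * v κ + b * w κ) = fun κ => a * projT dd db L v κ + b * projT dd db L w κ := by
  have h : (fun κ => a * v κ + b * w κ) = (fun κ => a * v κ) + (fun κ => b * w κ) := by
    funext κ; simp only [Pi.add_apply]
  rw [h, projT_add, projT_smul, projT_smul]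
  funext κ
  simp only [Pi.add_apply]

/-- [folklore] **HELMHOLTZ DECOMPOSITION ON THE FIBRE**: `v = Π⊥v + (∂♭·v / L)·∂` (transverse part + longitudinal part; definitionally). -/
theorem self_eq_projT_add (dd db : Fin D → ℂ) (L : ℂ) (v : Fin D → ℂ) :
    v = projT dd db L v + fun κ => (dot db v / L) * dd κ := by
  funext κ
  rw [Pi.add_apply, projT_apply, sub_add_cancel]

/-- [folklore] The longitudinal coefficient is recovered by pairing with `∂♭`: `∂♭·v = (∂♭·v / L)·L`, i.e. `∂♭·(v − Π⊥v) = ∂♭·v`. -/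
theorem dot_db_sub_projT (dd db : Fin D → ℂ) {L : ℂ} (hL : L ≠ 0) (hLdef : dot db dd = L) (v : Fin D → ℂ) :
    dot db (fun κ => v κ - projT dd db L v κ) = dot db v := by
  have h : (fun κ => v κ - projT dd db L v κ) = fun κ => (dot db v / L) * dd κ := by
    funext κ; rw [projT_apply]; ring
  rw [h, dot_smul_right, hLdef, div_mul_cancel₀ _ hL]

/-! ### 4. Transverse ∩ longitudinal = 0, and the `m = 0` cancellation (SKELETON-P1 A4′(iv)) -/

/-- [folklore] **A TRANSVERSE VECTOR THAT IS LONGITUDINAL VANISHES**: if `Π⊥X = t·∂` then `t = 0` (pair with `∂♭`: `0 = ∂♭·Π⊥X = t·L`, `L ≠ 0`). -/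
theorem eq_zero_of_projT_eq_smul_dd (dd db : Fin D → ℂ) {L : ℂ} (hL : L ≠ 0) (hLdef : dot db dd = L) {X : Fin D → ℂ} {t : ℂ}
    (h : projT dd db L X = fun κ => t * dd κ) : t = 0 := by
  have h0 := dot_db_projT dd db hL hLdef X
  rw [h, dot_smul_right, hLdef] at h0
  rcases mul_eq_zero.mp h0 with ht | hL0
  · exact ht
  · exact absurd hL0 hL

/-- [folklore] … hence the longitudinal vector itself vanishes: `Π⊥X = t·∂ ⇒ t·∂ = 0`. -/
theorem smul_dd_eq_zero_of_projT_eq (dd db : Fin D → ℂ) {L : ℂ} (hL : L ≠ 0) (hLdef : dot db dd = L) {X : Fin D → ℂ} {t : ℂ}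
    (h : projT dd db L X = fun κ => t * dd κ) : (fun κ => t * dd κ) = 0 := by
  rw [eq_zero_of_projT_eq_smul_dd dd db hL hLdef h]
  funext κ
  rw [zero_mul, Pi.zero_apply]

/-- [folklore] … and so does the transverse part: `Π⊥X = t·∂ ⇒ Π⊥X = 0`. -/
theorem projT_eq_zero_of_projT_eq_smul_dd (dd db : Fin D → ℂ) {L : ℂ} (hL : L ≠ 0) (hLdef : dot db dd = L) {X : Fin D → ℂ} {t : ℂ}
    (h : projT dd db L X = fun κ => t * dd κ) : projT dd db L X = 0 := by
  rw [h]; exact smul_dd_eq_zero_of_projT_eq dd db hL hLdef h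

/-- [folklore] If `c ≠ 0` and `Π⊥(c·Y) = 0` then `Π⊥Y = 0`. -/
theorem projT_eq_zero_of_smul (dd db : Fin D → ℂ) (L : ℂ) {c : ℂ} (hc : c ≠ 0) {Y : Fin D → ℂ}
    (h : projT dd db L (fun κ => c * Y κ) = 0) : projT dd db L Y = 0 := by
  rw [projT_smul] at h
  funext κ
  have hκ := congrFun h κ
  rw [Pi.zero_apply] at hκ ⊢
  rcases mul_eq_zero.mp hκ with h1 | h2
  · exact absurd h1 hc
  · exact h2

/-- [folklore] **THE `m = 0` CANCELLATION LEMMA** (`SKELETON-P1.md` A4′(iv), as algebra): let `σ♭ : Fin D → ℂ` be a diagonal weight, `S ≠ 0`, `χ` scalars with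
`w₀ = S·χ`, `f φ : Fin D → ℂ` vectors and `t` a scalar.  If the transverse part of the weighted feed is longitudinal,
`Π⊥(κ ↦ w₀ σ♭_κ φ_κ + S f_κ) = t·∂`, then `t·∂ = 0` AND the rescaled feed `κ ↦ f_κ + χ σ♭_κ φ_κ` is LONGITUDINAL: `Π⊥(κ ↦ f_κ + χ σ♭_κ φ_κ) = 0`.
(In S1b′: the `m = 0` capacitance equation forces `f̂(0) + χ̂₀ Σ̄₀ φ` to be longitudinal, so `Π⊥₀(f̂(0) + χ̂₀Σ̄₀φ)/(2L₀)` carries NO `1/|p|²` pole.) -/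
theorem cancellation (dd db : Fin D → ℂ) {L : ℂ} (hL : L ≠ 0) (hLdef : dot db dd = L) (σ f φ : Fin D → ℂ) {S χ w₀ t : ℂ}
    (hS : S ≠ 0) (hw : w₀ = S * χ)
    (h : projT dd db L (fun κ => w₀ * σ κ * φ κ + S * f κ) = fun κ => t * dd κ) :
    (fun κ => t * dd κ) = 0 ∧ projT dd db L (fun κ => f κ + χ * σ κ * φ κ) = 0 := by
  refine ⟨smul_dd_eq_zero_of_projT_eq dd db hL hLdef h, ?_⟩
  have hX : (fun κ => w₀ * σ κ * φ κ + S * f κ) = fun κ => S * (f κ + χ * σ κ * φ κ) := by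
    funext κ; rw [hw]; ring
  have h0 : projT dd db L (fun κ => S * (f κ + χ * σ κ * φ κ)) = 0 := by
    rw [← hX]; exact projT_eq_zero_of_projT_eq_smul_dd dd db hL hLdef h
  exact projT_eq_zero_of_smul dd db L hS h0

/-- [folklore] Converse direction used when ASSEMBLING the `m = 0` block: if the rescaled feed is longitudinal, `Π⊥(κ ↦ f_κ + χ σ♭_κ φ_κ) = 0`, then the
weighted feed has vanishing transverse part, `Π⊥(κ ↦ w₀ σ♭_κ φ_κ + S f_κ) = 0` (any `S`, `w₀ = S·χ`). -/
theorem projT_feed_eq_zero (dd db : Fin D → ℂ) (L : ℂ) (σ f φ : Fin D → ℂ) {S χ w₀ : ℂ} (hw : w₀ = S * χ)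
    (h : projT dd db L (fun κ => f κ + χ * σ κ * φ κ) = 0) :
    projT dd db L (fun κ => w₀ * σ κ * φ κ + S * f κ) = 0 := by
  have hX : (fun κ => w₀ * σ κ * φ κ + S * f κ) = fun κ => S * (f κ + χ * σ κ * φ κ) := by
    funext κ; rw [hw]; ring
  rw [hX, projT_smul, h]
  funext κ
  simp only [Pi.zero_apply, mul_zero]

/-- [folklore] THE FIELD SOLUTION OF `FibreBlockSolve` IN PROJECTOR FORM: `Asol ∂ ∂♭ g L cc = Π⊥g/(2L) + (cc/L²)·∂` (its transverse part is `Π⊥g/(2L)`,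
its longitudinal part the pure-gauge term driven by the block constant). -/
theorem Asol_eq_projT (dd db g : Fin D → ℂ) (L cc : ℂ) (κ : Fin D) :
    FibreBlockSolve.Asol dd db g L cc κ = projT dd db L g κ / (2 * L) + (cc / L ^ 2) * dd κ := by
  rw [FibreBlockSolve.Asol, projT_apply]
  ring

/-- [folklore] … so for a LONGITUDINAL feed (`Π⊥g = 0`) the field solution is pure gauge: `Asol = (cc/L²)·∂` — the form in which the cancellation lemma
enters the `m = 0` block of the field response. -/
theorem Asol_of_projT_eq_zero (dd db g : Fin D → ℂ) (L cc : ℂ) (hg : projT dd db L g = 0) (κ : Fin D) :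
    FibreBlockSolve.Asol dd db g L cc κ = (cc / L ^ 2) * dd κ := by
  rw [Asol_eq_projT, hg, Pi.zero_apply, zero_div, zero_add]

open scoped ComplexConjugate

/-! ### 5. Real data (`∂♭ = conj ∂`, i.e. a REAL fine momentum): `Π⊥` is the ORTHOGONAL projector onto `{v | ∂♭·v = 0}`
(v1.1, typer row P1-E2 (ii′) of `GAN24/Formal/LEAVES.md` v2).  At a real momentum `dflat k = conj ∘ dhat k`
(`FibreGaffney.dflat_eq_conj_dhat`, `SymbolTaylor.dflat_ofRealVec`), so the hypothesis `hreal` below is discharged by those lemmas. -/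

/-- [folklore] `dot` is symmetric. -/
theorem dot_comm (u v : Fin D → ℂ) : dot u v = dot v u := by
  unfold dot; exact Finset.sum_congr rfl fun κ _ => mul_comm _ _

/-- [folklore] Conjugating a pairing conjugates both slots. -/
theorem conj_dot (u v : Fin D → ℂ) : conj (dot u v) = dot (fun κ => conj (u κ)) (fun κ => conj (v κ)) := by
  unfold dot; rw [map_sum]; exact Finset.sum_congr rfl fun κ _ => map_mul _ _ _

/-- [folklore] `Σ_κ conj(v_κ) v_κ = ↑Σ_κ ‖v_κ‖²`. -/
theorem dot_conj_self (v : Fin D → ℂ) : dot (fun κ => conj (v κ)) v = ((∑ κ, Complex.normSq (v κ) : ℝ) : ℂ) := by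
  unfold dot; rw [Complex.ofReal_sum]; exact Finset.sum_congr rfl fun κ _ => by rw [Complex.normSq_eq_conj_mul_self]

/-- [folklore] For real data the Laplacian symbol is the real number `Σ_κ ‖∂_κ‖²`. -/
theorem L_eq_sum_normSq {dd db : Fin D → ℂ} (hreal : ∀ κ, db κ = conj (dd κ)) {L : ℂ} (hLdef : dot db dd = L) :
    L = ((∑ κ, Complex.normSq (dd κ) : ℝ) : ℂ) := by
  rw [← hLdef, ← dot_conj_self]
  unfold dot; exact Finset.sum_congr rfl fun κ _ => by rw [hreal]

/-- [folklore] … in particular `conj L = L`. -/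
theorem conj_L {dd db : Fin D → ℂ} (hreal : ∀ κ, db κ = conj (dd κ)) {L : ℂ} (hLdef : dot db dd = L) : conj L = L := by
  rw [L_eq_sum_normSq hreal hLdef, Complex.conj_ofReal]

/-- [folklore] … and `L ≠ 0` forces `0 < Σ‖∂_κ‖² = Re L`. -/
theorem L_re_pos {dd db : Fin D → ℂ} (hreal : ∀ κ, db κ = conj (dd κ)) {L : ℂ} (hL : L ≠ 0) (hLdef : dot db dd = L) :
    0 < L.re := by
  have hL' := L_eq_sum_normSq hreal hLdef
  have hnn : 0 ≤ ∑ κ, Complex.normSq (dd κ) := Finset.sum_nonneg fun κ _ => Complex.normSq_nonneg _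
  rw [hL', Complex.ofReal_re]
  rcases hnn.lt_or_eq with h | h
  · exact h
  · exact absurd (by rw [hL', ← h, Complex.ofReal_zero]) hL

/-- [folklore] For real data `∂♭·v̄ = conj(∂·v)`-type bookkeeping: `Σ_κ conj(v_κ) ∂_κ = conj (∂♭·v)`. -/
theorem dot_conj_dd {dd db : Fin D → ℂ} (hreal : ∀ κ, db κ = conj (dd κ)) (v : Fin D → ℂ) :
    dot (fun κ => conj (v κ)) dd = conj (dot db v) := by
  simp only [dot, map_sum, map_mul]
  exact Finset.sum_congr rfl fun κ _ => by rw [hreal, Complex.conj_conj, mul_comm]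

/-- [folklore] **SELF-ADJOINTNESS** of `Π⊥` for real data: `⟨u, Π⊥v⟩ = conj ⟨v, Π⊥u⟩` (with `⟨a, b⟩ = Σ conj(a_κ) b_κ`). -/
theorem inner_projT_comm {dd db : Fin D → ℂ} (hreal : ∀ κ, db κ = conj (dd κ)) {L : ℂ} (hLdef : dot db dd = L)
    (u v : Fin D → ℂ) :
    dot (fun κ => conj (u κ)) (projT dd db L v) = conj (dot (fun κ => conj (v κ)) (projT dd db L u)) := by
  have F1 : conj (dot (fun κ => conj (v κ)) u) = dot (fun κ => conj (u κ)) v := by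
    simp only [dot, map_sum, map_mul, Complex.conj_conj]
    exact Finset.sum_congr rfl fun κ _ => mul_comm _ _
  have F4 : conj (dot (fun κ => conj (v κ)) dd) = dot db v := by
    rw [dot_conj_dd hreal v, Complex.conj_conj]
  rw [dot_projT, dot_projT, map_sub, map_mul, map_div₀, conj_L hreal hLdef, F1, F4, ← dot_conj_dd hreal u]
  ring

/-- [folklore] **`⟨v, Π⊥v⟩ = ‖Π⊥v‖²`** for real data (so each capacitance summand `Σ Π⊥ Σ̄/(2L)` of S1b′ is positive semidefinite). -/
theorem inner_projT_self {dd db : Fin D → ℂ} (hreal : ∀ κ, db κ = conj (dd κ)) {L : ℂ} (hL : L ≠ 0) (hLdef : dot db dd = L)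
    (v : Fin D → ℂ) :
    dot (fun κ => conj (v κ)) (projT dd db L v) = ((∑ κ, Complex.normSq (projT dd db L v κ) : ℝ) : ℂ) := by
  rw [← dot_conj_self]
  -- `⟨Π⊥v, Π⊥v⟩ = ⟨v, Π⊥v⟩ − conj(c)·(∂♭·Π⊥v)` and the last pairing vanishes
  have h : (fun κ => conj (projT dd db L v κ)) = fun κ => conj (v κ) + (-(conj (dot db v / L))) * db κ := by
    funext κ; rw [projT_apply, map_sub, map_mul, hreal]; ring
  have e : (fun κ => conj (v κ) + (-(conj (dot db v / L))) * db κ)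
      = (fun κ => conj (v κ)) + (fun κ => (-(conj (dot db v / L))) * db κ) := by
    funext κ; simp only [Pi.add_apply]
  rw [h, e, dot_comm ((fun κ => conj (v κ)) + fun κ => (-(conj (dot db v / L))) * db κ) (projT dd db L v),
    dot_add_right, dot_smul_right, dot_comm (projT dd db L v) db, dot_db_projT dd db hL hLdef v, mul_zero, add_zero,
    dot_comm (projT dd db L v) (fun κ => conj (v κ))]

/-- [folklore] **PYTHAGORAS ON THE FIBRE** (real data): `Σ‖v_κ‖² = Σ‖(Π⊥v)_κ‖² + ‖∂♭·v‖²/L` — transverse plus longitudinal energy. -/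
theorem sum_normSq_eq_projT_add {dd db : Fin D → ℂ} (hreal : ∀ κ, db κ = conj (dd κ)) {L : ℂ} (hL : L ≠ 0)
    (hLdef : dot db dd = L) (v : Fin D → ℂ) :
    ∑ κ, Complex.normSq (v κ) = ∑ κ, Complex.normSq (projT dd db L v κ) + Complex.normSq (dot db v) / L.re := by
  have h1 := inner_projT_self hreal hL hLdef v
  rw [dot_projT, dot_conj_self, dot_conj_dd hreal v] at h1
  -- `h1 : ↑Σ‖v‖² − (∂♭·v / L)·conj(∂♭·v) = ↑Σ‖Π⊥v‖²`
  have hre : ((L.re : ℝ) : ℂ) = L := by rw [L_eq_sum_normSq hreal hLdef, Complex.ofReal_re]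
  have e : dot db v / L * conj (dot db v) = ((Complex.normSq (dot db v) / L.re : ℝ) : ℂ) := by
    rw [Complex.ofReal_div, hre, ← Complex.mul_conj]; ring
  rw [e] at h1
  have h2 : (∑ κ, Complex.normSq (v κ)) - Complex.normSq (dot db v) / L.re = ∑ κ, Complex.normSq (projT dd db L v κ) := by
    exact_mod_cast h1
  linarith

/-- [folklore] `Π⊥` is a CONTRACTION for real data: `Σ‖(Π⊥v)_κ‖² ≤ Σ‖v_κ‖²` (the «sharper transverse form» of the solution bounds). -/
theorem sum_normSq_projT_le {dd db : Fin D → ℂ} (hreal : ∀ κ, db κ = conj (dd κ)) {L : ℂ} (hL : L ≠ 0)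
    (hLdef : dot db dd = L) (v : Fin D → ℂ) :
    ∑ κ, Complex.normSq (projT dd db L v κ) ≤ ∑ κ, Complex.normSq (v κ) := by
  rw [sum_normSq_eq_projT_add hreal hL hLdef v]
  exact le_add_of_nonneg_right (div_nonneg (Complex.normSq_nonneg _) (L_re_pos hreal hL hLdef).le)

/-- [folklore] The form `⟨v, Π⊥v⟩` is real and nonnegative for real data. -/
theorem inner_projT_self_re_nonneg {dd db : Fin D → ℂ} (hreal : ∀ κ, db κ = conj (dd κ)) {L : ℂ} (hL : L ≠ 0)
    (hLdef : dot db dd = L) (v : Fin D → ℂ) :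
    0 ≤ (dot (fun κ => conj (v κ)) (projT dd db L v)).re ∧ (dot (fun κ => conj (v κ)) (projT dd db L v)).im = 0 := by
  rw [inner_projT_self hreal hL hLdef v, Complex.ofReal_re, Complex.ofReal_im]
  exact ⟨Finset.sum_nonneg fun κ _ => Complex.normSq_nonneg _, rfl⟩

/-! ### 6. Componentwise bounds for the explicit block solution of `FibreBlockSolve` (typer row P1-E2 (iii); any complex data —
at `L = 0` both sides vanish by the `x/0 = 0` convention, so no hypothesis is needed) -/

/-- [folklore] `‖u·v‖ ≤ Σ_κ ‖u_κ‖‖v_κ‖`. -/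
theorem norm_dot_le (u v : Fin D → ℂ) : ‖dot u v‖ ≤ ∑ κ, ‖u κ‖ * ‖v κ‖ := by
  unfold dot
  exact (norm_sum_le _ _).trans (le_of_eq (Finset.sum_congr rfl fun κ _ => norm_mul _ _))

/-- [folklore] **GAUGE-MULTIPLIER BOUND**: `‖musol ∂♭ g L‖ ≤ (Σ_l ‖∂♭_l‖‖g_l‖)/‖L‖²`. -/
theorem norm_musol_le (db g : Fin D → ℂ) (L : ℂ) :
    ‖FibreBlockSolve.musol db g L‖ ≤ (∑ l, ‖db l‖ * ‖g l‖) / ‖L‖ ^ 2 := by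
  rw [FibreBlockSolve.musol, norm_div, norm_neg, norm_pow]
  exact div_le_div_of_nonneg_right (norm_dot_le db g) (pow_nonneg (norm_nonneg _) 2)

/-- [folklore] **TRANSVERSE-PART BOUND** (componentwise, any data): `‖(Π⊥g)_κ‖ ≤ ‖g_κ‖ + ‖∂_κ‖·(Σ_l ‖∂♭_l‖‖g_l‖)/‖L‖`. -/
theorem norm_projT_apply_le (dd db g : Fin D → ℂ) (L : ℂ) (κ : Fin D) :
    ‖projT dd db L g κ‖ ≤ ‖g κ‖ + ‖dd κ‖ * (∑ l, ‖db l‖ * ‖g l‖) / ‖L‖ := by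
  rw [projT_apply]
  refine (norm_sub_le _ _).trans (add_le_add le_rfl ?_)
  rw [norm_mul, norm_div, mul_comm, mul_div_assoc]
  exact mul_le_mul_of_nonneg_left (div_le_div_of_nonneg_right (norm_dot_le db g) (norm_nonneg _)) (norm_nonneg _)

/-- [folklore] **FIELD-SOLUTION BOUND** (componentwise): `‖Asol ∂ ∂♭ g L cc κ‖ ≤ (‖g_κ‖ + ‖∂_κ‖(Σ_l ‖∂♭_l‖‖g_l‖)/‖L‖)/(2‖L‖) + ‖cc‖‖∂_κ‖/‖L‖²`
— transverse propagator `1/(2L)` on `Π⊥g` plus the pure-gauge part. -/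
theorem norm_Asol_le (dd db g : Fin D → ℂ) (L cc : ℂ) (κ : Fin D) :
    ‖FibreBlockSolve.Asol dd db g L cc κ‖
      ≤ (‖g κ‖ + ‖dd κ‖ * (∑ l, ‖db l‖ * ‖g l‖) / ‖L‖) / (2 * ‖L‖) + ‖cc‖ * ‖dd κ‖ / ‖L‖ ^ 2 := by
  rw [Asol_eq_projT]
  refine (norm_add_le _ _).trans (add_le_add ?_ (le_of_eq ?_))
  · rw [norm_div, norm_mul, Complex.norm_ofNat]
    exact div_le_div_of_nonneg_right (norm_projT_apply_le dd db g L κ) (by positivity)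
  · rw [norm_mul, norm_div, norm_pow, div_mul_eq_mul_div]

/-! ### 7. The cancellation lemma WITH REMAINDER (v1.2; leaf-03-g4's XREAD INFO I1, journal 2026-08-19T23:39:29Z): in S1b′ the `m = 0`
capacitance rows give `Π⊥X = t·∂ + r` only up to a remainder `r` (the `ĉ`-source and the `m ≠ 0` alias terms), so the usable form of
A4′(iv) is: the longitudinal coefficient is fixed by `r` (`t·L = −∂♭·r`) and the transverse part of the feed IS the transverse part of the
remainder (`Π⊥X = Π⊥r`) — no `O(1)` numerator survives at the `m = 0` pole except what `r` carries. -/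

/-- [folklore] **CANCELLATION WITH REMAINDER**: `Π⊥X = t·∂ + r ⇒ t·L = −∂♭·r ∧ Π⊥X = Π⊥r`. -/
theorem cancellation_remainder (dd db : Fin D → ℂ) {L : ℂ} (hL : L ≠ 0) (hLdef : dot db dd = L) {X r : Fin D → ℂ} {t : ℂ}
    (h : projT dd db L X = fun κ => t * dd κ + r κ) :
    t * L = -dot db r ∧ projT dd db L X = projT dd db L r := by
  have hsplit : (fun κ => t * dd κ + r κ) = (fun κ => t * dd κ) + r := by
    funext κ; simp only [Pi.add_apply]
  have h0 := dot_db_projT dd db hL hLdef X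
  rw [h, hsplit, dot_add_right, dot_smul_right, hLdef] at h0
  refine ⟨by linear_combination h0, ?_⟩
  rw [← projT_idem dd db hL hLdef X, h, hsplit, projT_add, projT_smul_dd dd db hL hLdef, zero_add]

/-- [folklore] … in the packaging of `cancellation` (`w₀ = S·χ`, `S ≠ 0`): `Π⊥(κ ↦ w₀σ♭_κφ_κ + S f_κ) = t·∂ + r ⇒
Π⊥(κ ↦ f_κ + χσ♭_κφ_κ) = S⁻¹·Π⊥r` (the rescaled feed is longitudinal up to the rescaled transverse remainder). -/
theorem cancellation_remainder_feed (dd db : Fin D → ℂ) {L : ℂ} (hL : L ≠ 0) (hLdef : dot db dd = L) (σ f φ r : Fin D → ℂ)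
    {S χ w₀ t : ℂ} (hS : S ≠ 0) (hw : w₀ = S * χ)
    (h : projT dd db L (fun κ => w₀ * σ κ * φ κ + S * f κ) = fun κ => t * dd κ + r κ) :
    projT dd db L (fun κ => f κ + χ * σ κ * φ κ) = fun κ => S⁻¹ * projT dd db L r κ := by
  have hX : (fun κ => w₀ * σ κ * φ κ + S * f κ) = fun κ => S * (f κ + χ * σ κ * φ κ) := by
    funext κ; rw [hw]; ring
  have h2 := (cancellation_remainder dd db hL hLdef h).2
  rw [hX, projT_smul] at h2
  funext κ
  have hκ := congrFun h2 κ
  rw [← hκ, ← mul_assoc, inv_mul_cancel₀ hS, one_mul]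

end Summit.QuantumFields.BalabanUV.Beta.GAN24.TransverseProjector

end
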